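import Literature.IUT.HodgeTheaters.PiAvatarLabelRange
import HarnessLib

/-!
# AFFINENESS of the derived cusp action `actF` of `N(Π_{X̲_K})` on `Cusp(X̲_K)` in the chart based at `ε⁰`:
# `gChart₀ (n·x) = slope(n) · gChart₀ x + gChart₀ (n·ε⁰)` — [IUTchI] Def 6.1 (v) at the genuine `𝒟^{⊚±}`
# (post-freeze additive D13 piece; two small defs `actFSlope`, `actFSlopeHom` + proofs; not a cone member)

S. Mochizuki, *Inter-universal Teichmüller theory I*, kurims manuscript (May 2020), Def 6.1 (v) p. 158 («`Aut(𝒟^{⊚±})` acts on the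
cusps of `X̲_K` … the natural `𝔽_l^±`-torsor structure on `LabCusp^±(𝒟^{⊚±})`», «natural outer isomorphisms
`Aut_K(X̲_K) ⥲ Aut_±(𝒟^{⊚±})/Aut_csp(𝒟^{⊚±}) ⥲ 𝔽_l^{⋊±}`», «the natural surjective homomorphism `Aut(𝒟^{⊚±}) ↠ 𝔽_l^⋇` … rank one
quotient»), Ex 4.3 (i) pp. 98–99 («semi-unipotent, up to `±1`» and «Borel» subgroups) ([IUTchI] Def 6.1 (v) p.158)
[claim: Mochizuki2012, status: disputed] (D-0012 claim key, series status DISPUTED — kernel theorems over abc-iut-L5-t2's REAL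
`InitialThetaData`, abc-iut-L5-t1's `CuspGalois`, under the hypothesis binder `hS : D.CuspClassesNormaliserStable` of G-L5t4g3-3;
nothing of the series is asserted, no side is taken on [IUTchIII] Cor. 3.12).

WHY / WHO.  Item (1) steps 1–2 of abc-iut-L5-t4's next-seat plan (HOME/staging/L5/L5-t4/next/README.md; file name and helper
shape `affine_of_map_add_one` are t4's), written by the abc-iut-L5-t3 lineage because the `𝒟^⊚`-side label kit (NFK, RULINGS #31)
needs it now: it is the common input of t4's kit laws `gLab_range` (← half) / `autCsp_le` at `𝒟^{⊚±}` AND of the action of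
`Aut(𝒟^⊚) = N(Π_{C̲_K})/Π_{C̲_K}` on `LabCusp(𝒟^⊚)` through `𝔽_l^⋇` (Ex 4.3 (i)).  Steps 3–4 (slope = d065's `conjExponent`, the two
kit laws) are left to the t4 lineage.

WHAT IS PROVED (for `D : InitialThetaData`, `CG : D.geom.pe.CuspGalois`, `hS`, `[Fact l.Prime]`, `n ∈ N_{Π_{C_F}}(Π_{X̲_K})`; the
chart is t4's `gChart₀ = D.gChart₀Model CG`, based at `ε⁰`):
* `InitialThetaData.actFSlope CG hS n : ZMod l := gChart₀ (n·ε′) − gChart₀ (n·ε⁰)` (choice-free) and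
  **`labChart_actF : gChart₀ (actF n x) = actFSlope n * gChart₀ x + gChart₀ (actF n ε⁰)`** — the permutation `actF n` is AFFINE
  for the group law of the cusps with origin `ε⁰`: translation part = t4's `labChart_act_of_mem_PiX`, the step `f (z+1) = f z + d` =
  t4's equivariance `actF_act` (p431407) at `g = gen`;
* `actFSlope_ne_zero`, `actFSlopeUnit`, `actFSlope_one`, `actFSlope_mul`, **`actFSlopeHom : ↥N(Π_{X̲_K}) →* (ZMod l)ˣ`** (the linear
  part is a character — print's lower-right Borel entry);
* values: `actFSlope_eq_one_of_mem_PiXund` (Π_{X̲_K} acts trivially), `actFSlope_embK_of_mem_PiX` (`Gal(X̲_K/X_K)`: translations,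
  slope `1`), `actFSlope_embK_of_not_mem_PiX` (the `±`-involution, `Π_C̲ ∖ Π_X`: slope `−1`, (K2)), `actF_embK_ε0_of_mem_PiCbar`
  (`Π_C̲` fixes `ε⁰`).
No instance/notation; typed ≠ proved elsewhere.
-/

noncomputable section

namespace Literature.IUT.HodgeTheaters

open scoped Pointwise

universe u v w

/-- A self-map of `ZMod l` that commutes with `+1` up to a constant `d` is affine: `f z = d * z + f 0` (abc-iut-L5-t4's helper
shape, next-seat plan). [folklore] -/
private theorem affine_of_map_add_one {l : ℕ} [NeZero l] (f : ZMod l → ZMod l) (d : ZMod l)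
    (h : ∀ z, f (z + 1) = f z + d) : ∀ z, f z = d * z + f 0 := by
  have hnat : ∀ k : ℕ, f (k : ZMod l) = d * (k : ZMod l) + f 0 := by
    intro k
    induction k with
    | zero => simp
    | succ k ih => rw [Nat.cast_succ, h, ih]; ring
  intro z
  have hz : ((z.val : ℕ) : ZMod l) = z := ZMod.natCast_zmod_val z
  rw [← hz]
  exact hnat z.val

section LabelAffine

variable {F : Type u} {K : Type v} {Fbar : Type w} [Field F] [NumberField F] [Field K] [NumberField K]
  [Algebra F K] [Field Fbar] [Algebra F Fbar] [Algebra K Fbar]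
  {E : WeierstrassCurve F} [E.IsElliptic] {l : ℕ} {Pb : BadPlacePredicates K}
  (D : InitialThetaData F K Fbar E l Pb) (CG : D.geom.pe.CuspGalois) (hS : D.CuspClassesNormaliserStable)

namespace InitialThetaData

variable [Fact l.Prime]

/-! ### The chart based at `ε⁰` and t1's action: translations and the reflection -/

/-- In the chart based at `ε⁰`, `g ∈ Π_X` acts by the translation `+ gChart₀ (g·ε⁰)` (t4's `labChart_act_of_mem_PiX`, at the
instance `D.geom.pe`). ([IUTchI] Def 6.1 (v) p.158) [claim: Mochizuki2012, status: disputed] -/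
theorem gChart₀Model_act_of_mem_PiX {g : D.geom.pe.PiC} (hg : g ∈ D.geom.pe.PiX) (x : D.geom.pe.Cusp) :
    D.gChart₀Model CG (CG.act g x) = D.gChart₀Model CG x + D.gChart₀Model CG (CG.act g D.geom.pe.ε0) :=
  CG.labChart_act_of_mem_PiX _ hg x

/-- The generator `σ = act gen` reads `z ↦ z + 1` in the chart based at `ε⁰` (`gen·ε⁰ = ε′ ↦ 1`).
([IUTchI] Def 6.1 (v) p.158) [claim: Mochizuki2012, status: disputed] -/
theorem gChart₀Model_act_gen (x : D.geom.pe.Cusp) :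
    D.gChart₀Model CG (CG.act CG.gen x) = D.gChart₀Model CG x + 1 := by
  rw [D.gChart₀Model_act_of_mem_PiX CG CG.gen_mem, CG.act_gen_ε0, D.gChart₀Model_ε1 CG]

/-- `gChart₀⁻¹ (z + 1) = gen · gChart₀⁻¹ z`. ([IUTchI] Def 6.1 (v) p.158) [claim: Mochizuki2012, status: disputed] -/
theorem gChart₀Model_symm_add_one (z : ZMod l) :
    (D.gChart₀Model CG).symm (z + 1) = CG.act CG.gen ((D.gChart₀Model CG).symm z) := by
  apply (D.gChart₀Model CG).injective
  rw [Equiv.apply_symm_apply, D.gChart₀Model_act_gen CG, Equiv.apply_symm_apply]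

/-! ### Affineness of `actF n` -/

/-- **The slope of `actF n`** in the chart based at `ε⁰`: `gChart₀ (n·ε′) − gChart₀ (n·ε⁰)` (the linear part of the affine map,
choice-free; cf. `gChart₀Model_actF`). ([IUTchI] Def 6.1 (v) p.158) [claim: Mochizuki2012, status: disputed] -/
def actFSlope (n : ↥(Subgroup.normalizer ((D.PiXund : Subgroup D.PiC) : Set D.PiC))) : ZMod l :=
  D.gChart₀Model CG (D.actF CG hS n D.geom.pe.ε1) - D.gChart₀Model CG (D.actF CG hS n D.geom.pe.ε0)

/-- **AFFINENESS of `actF n`** ([IUTchI] Def 6.1 (v): `Aut(𝒟^{⊚±})` acts on the cusps compatibly with their `𝔽_l^±`-structure —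
here: through the Borel group `z ↦ u z + b`): `gChart₀ (actF n x) = actFSlope n * gChart₀ x + gChart₀ (actF n ε⁰)` for every
`n ∈ N(Π_{X̲_K})`.  Proof: t4's equivariance `actF_act` with `g = gen` gives `f (z + 1) = f z + d` for the chart conjugate `f` of
`actF n`, `d = gChart₀ (g′·ε⁰)` where `embK g′ = n·embK gen·n⁻¹`; hence `f` is affine; evaluating at `ε′` identifies `d`.
([IUTchI] Def 6.1 (v) p.158) [claim: Mochizuki2012, status: disputed] -/
theorem gChart₀Model_actF (n : ↥(Subgroup.normalizer ((D.PiXund : Subgroup D.PiC) : Set D.PiC))) (x : D.geom.pe.Cusp) :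
    D.gChart₀Model CG (D.actF CG hS n x) =
      D.actFSlope CG hS n * D.gChart₀Model CG x + D.gChart₀Model CG (D.actF CG hS n D.geom.pe.ε0) := by
  haveI : NeZero l := ⟨(Fact.out : l.Prime).ne_zero⟩
  -- the conjugate `g′` of `gen` by `n`, an element of `Π_X`
  obtain ⟨g', hg'⟩ := D.exists_embK_eq_conj n CG.gen
  have hg'X : g' ∈ D.geom.pe.PiX := D.mem_PiX_of_embK_eq_conj n CG.gen_mem hg'
  set e := D.gChart₀Model CG with he
  set d : ZMod l := e (CG.act g' D.geom.pe.ε0) with hd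
  -- the chart conjugate of `actF n`
  set f : ZMod l → ZMod l := fun z => e (D.actF CG hS n (e.symm z)) with hf
  have hstep : ∀ z, f (z + 1) = f z + d := by
    intro z
    simp only [hf]
    rw [he, D.gChart₀Model_symm_add_one CG z, D.actF_act CG hS n CG.gen g' hg',
      D.gChart₀Model_act_of_mem_PiX CG hg'X]
  have haff := affine_of_map_add_one f d hstep
  have hsymm0 : e.symm 0 = D.geom.pe.ε0 := by
    apply e.injective
    rw [Equiv.apply_symm_apply, he, D.gChart₀Model_ε0 CG]
  -- the formula with `d`, at every cusp
  have key : ∀ y, e (D.actF CG hS n y) = d * e y + e (D.actF CG hS n D.geom.pe.ε0) := by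
    intro y
    have h := haff (e y)
    simp only [hf, Equiv.symm_apply_apply, hsymm0] at h
    exact h
  -- `d` is the slope: evaluate at `ε′`
  have hdslope : d = D.actFSlope CG hS n := by
    have h1 := key D.geom.pe.ε1
    rw [he, D.gChart₀Model_ε1 CG, mul_one] at h1
    rw [actFSlope, h1, ← he, add_sub_cancel_right]
  rw [← hdslope]
  exact key x

/-- The slope of `actF n` is nonzero (`actF n` is injective and `ε′ ≠ ε⁰`). ([IUTchI] Def 6.1 (v) p.158) [claim: Mochizuki2012, status: disputed] -/
theorem actFSlope_ne_zero (n : ↥(Subgroup.normalizer ((D.PiXund : Subgroup D.PiC) : Set D.PiC))) :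
    D.actFSlope CG hS n ≠ 0 := by
  intro h0
  have h1 := D.gChart₀Model_actF CG hS n D.geom.pe.ε1
  rw [h0, zero_mul, zero_add] at h1
  have h2 : D.actF CG hS n D.geom.pe.ε1 = D.actF CG hS n D.geom.pe.ε0 := (D.gChart₀Model CG).injective h1
  exact D.geom.pe.ε1_ne_ε0 ((D.actF CG hS n).injective h2)

/-- The slope as a unit of `𝔽_l` (`l` prime). ([IUTchI] Def 6.1 (v) p.158) [claim: Mochizuki2012, status: disputed] -/
def actFSlopeUnit (n : ↥(Subgroup.normalizer ((D.PiXund : Subgroup D.PiC) : Set D.PiC))) : (ZMod l)ˣ :=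
  Units.mk0 (D.actFSlope CG hS n) (D.actFSlope_ne_zero CG hS n)

/-- `(actFSlopeUnit n : ZMod l) = actFSlope n`. ([IUTchI] Def 6.1 (v) p.158) [claim: Mochizuki2012, status: disputed] -/
@[simp] theorem val_actFSlopeUnit (n : ↥(Subgroup.normalizer ((D.PiXund : Subgroup D.PiC) : Set D.PiC))) :
    ((D.actFSlopeUnit CG hS n : (ZMod l)ˣ) : ZMod l) = D.actFSlope CG hS n := rfl

/-- The identity has slope `1`. ([IUTchI] Def 6.1 (v) p.158) [claim: Mochizuki2012, status: disputed] -/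
theorem actFSlope_one : D.actFSlope CG hS 1 = 1 := by
  rw [actFSlope, map_one, Equiv.Perm.one_apply, Equiv.Perm.one_apply, D.gChart₀Model_ε1 CG, D.gChart₀Model_ε0 CG, sub_zero]

/-- **Slopes multiply**: `slope (n m) = slope n * slope m` (composition of affine maps).
([IUTchI] Def 6.1 (v) p.158) [claim: Mochizuki2012, status: disputed] -/
theorem actFSlope_mul (n m : ↥(Subgroup.normalizer ((D.PiXund : Subgroup D.PiC) : Set D.PiC))) :
    D.actFSlope CG hS (n * m) = D.actFSlope CG hS n * D.actFSlope CG hS m := by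
  have h1 : D.gChart₀Model CG (D.actF CG hS (n * m) D.geom.pe.ε1) =
      D.actFSlope CG hS n * (D.actFSlope CG hS m * 1 + D.gChart₀Model CG (D.actF CG hS m D.geom.pe.ε0)) +
        D.gChart₀Model CG (D.actF CG hS n D.geom.pe.ε0) := by
    rw [map_mul, Equiv.Perm.mul_apply, D.gChart₀Model_actF CG hS n, D.gChart₀Model_actF CG hS m, D.gChart₀Model_ε1 CG]
  have h0 : D.gChart₀Model CG (D.actF CG hS (n * m) D.geom.pe.ε0) =
      D.actFSlope CG hS n * D.gChart₀Model CG (D.actF CG hS m D.geom.pe.ε0) +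
        D.gChart₀Model CG (D.actF CG hS n D.geom.pe.ε0) := by
    rw [map_mul, Equiv.Perm.mul_apply]
    exact D.gChart₀Model_actF CG hS n _
  rw [actFSlope, h1, h0]
  ring

/-- **The slope character `N(Π_{X̲_K}) → 𝔽_l^×`** (the linear part of the affine cusp action; print: the lower-right entry of the
Borel subgroup `{(∗ ∗; 0 ∗)}` of Ex 4.3 (i) / the action on the rank one quotient of Def 6.1 (v)).
([IUTchI] Def 6.1 (v) p.158) [claim: Mochizuki2012, status: disputed] -/
def actFSlopeHom : ↥(Subgroup.normalizer ((D.PiXund : Subgroup D.PiC) : Set D.PiC)) →* (ZMod l)ˣ where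
  toFun := D.actFSlopeUnit CG hS
  map_one' := Units.ext (by rw [val_actFSlopeUnit, Units.val_one, D.actFSlope_one CG hS])
  map_mul' n m := Units.ext (by rw [Units.val_mul, val_actFSlopeUnit, val_actFSlopeUnit, val_actFSlopeUnit,
    D.actFSlope_mul CG hS])

/-- `actFSlopeHom n = actFSlopeUnit n`. ([IUTchI] Def 6.1 (v) p.158) [claim: Mochizuki2012, status: disputed] -/
@[simp] theorem actFSlopeHom_apply (n : ↥(Subgroup.normalizer ((D.PiXund : Subgroup D.PiC) : Set D.PiC))) :
    D.actFSlopeHom CG hS n = D.actFSlopeUnit CG hS n := rfl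

/-! ### Values of the slope -/

/-- Elements of `Π_{X̲_K}` act trivially, so their slope is `1`. ([IUTchI] Def 6.1 (v) p.158) [claim: Mochizuki2012, status: disputed] -/
theorem actFSlope_eq_one_of_mem_PiXund (n : ↥(Subgroup.normalizer ((D.PiXund : Subgroup D.PiC) : Set D.PiC)))
    (hn : (n : D.PiC) ∈ D.PiXund) : D.actFSlope CG hS n = 1 := by
  rw [actFSlope, D.actF_eq_one_of_mem_PiXund CG hS n hn, Equiv.Perm.one_apply, Equiv.Perm.one_apply,
    D.gChart₀Model_ε1 CG, D.gChart₀Model_ε0 CG, sub_zero]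

/-- **Translations have slope `1`**: for `g ∈ Π_X` (the deck group `Gal(X̲_K/X_K)` and all of `Π_{X_K}`), `actF (embK g)` is
`z ↦ z + gChart₀ (g·ε⁰)`. ([IUTchI] Def 6.1 (v) p.158) [claim: Mochizuki2012, status: disputed] -/
theorem actFSlope_embK_of_mem_PiX {g : D.geom.pe.PiC} (hg : g ∈ D.geom.pe.PiX)
    (hn : D.geom.embK g ∈ Subgroup.normalizer ((D.PiXund : Subgroup D.PiC) : Set D.PiC)) :
    D.actFSlope CG hS ⟨D.geom.embK g, hn⟩ = 1 := by
  rw [actFSlope, D.actF_embK CG hS g hn, D.gChart₀Model_act_of_mem_PiX CG hg D.geom.pe.ε1,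
    D.gChart₀Model_ε1 CG, D.gChart₀Model_act_of_mem_PiX CG hg D.geom.pe.ε0, D.gChart₀Model_ε0 CG]
  ring

/-- **The `±`-involution has slope `−1`**: for `c ∈ Π_C̲ ∖ Π_X`, `actF (embK c)` is `z ↦ −z` ((K2): t4's
`labChart_act_of_not_mem_PiX`). ([IUTchI] Def 6.1 (v) p.158) [claim: Mochizuki2012, status: disputed] -/
theorem actFSlope_embK_of_not_mem_PiX {c : D.geom.pe.PiC} (hc : c ∈ D.geom.pe.PiCbar) (hcX : c ∉ D.geom.pe.PiX)
    (hn : D.geom.embK c ∈ Subgroup.normalizer ((D.PiXund : Subgroup D.PiC) : Set D.PiC)) :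
    D.actFSlope CG hS ⟨D.geom.embK c, hn⟩ = -1 := by
  rw [actFSlope, D.actF_embK CG hS c hn]
  rw [show D.gChart₀Model CG (CG.act c D.geom.pe.ε1) = - D.gChart₀Model CG D.geom.pe.ε1 from
      CG.labChart_act_of_not_mem_PiX _ hc hcX _,
    show D.gChart₀Model CG (CG.act c D.geom.pe.ε0) = - D.gChart₀Model CG D.geom.pe.ε0 from
      CG.labChart_act_of_not_mem_PiX _ hc hcX _,
    D.gChart₀Model_ε1 CG, D.gChart₀Model_ε0 CG]
  ring

/-- In the chart, `c ∈ Π_C̲ ∖ Π_X` acts by `z ↦ −z` through `actF` (t4's (K2) pushed to `actF` by `actF_embK`).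
([IUTchI] Def 6.1 (v) p.158) [claim: Mochizuki2012, status: disputed] -/
theorem gChart₀Model_actF_embK_of_not_mem_PiX {c : D.geom.pe.PiC} (hc : c ∈ D.geom.pe.PiCbar) (hcX : c ∉ D.geom.pe.PiX)
    (hn : D.geom.embK c ∈ Subgroup.normalizer ((D.PiXund : Subgroup D.PiC) : Set D.PiC)) (x : D.geom.pe.Cusp) :
    D.gChart₀Model CG (D.actF CG hS ⟨D.geom.embK c, hn⟩ x) = - D.gChart₀Model CG x := by
  rw [D.actF_embK CG hS c hn]
  exact CG.labChart_act_of_not_mem_PiX _ hc hcX x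

omit [Fact l.Prime] in
/-- `Π_C̲` fixes the zero cusp through `actF` (t1's `act_ε0`). ([IUTchI] §1 p.37) [claim: Mochizuki2012, status: disputed] -/
theorem actF_embK_ε0_of_mem_PiCbar {c : D.geom.pe.PiC} (hc : c ∈ D.geom.pe.PiCbar)
    (hn : D.geom.embK c ∈ Subgroup.normalizer ((D.PiXund : Subgroup D.PiC) : Set D.PiC)) :
    D.actF CG hS ⟨D.geom.embK c, hn⟩ D.geom.pe.ε0 = D.geom.pe.ε0 := by
  rw [D.actF_embK CG hS c hn]
  exact CG.act_ε0 c hc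

/-- The slope of an element of `Π_{C̲_K} = embK(Π_C̲)` is `±1` (translation-free part of `Gal(X̲_K/C̲_K) = {1, ι}`).
([IUTchI] Def 6.1 (v) p.158) [claim: Mochizuki2012, status: disputed] -/
theorem actFSlope_eq_one_or_eq_neg_one_of_mem_PiCund (n : ↥(Subgroup.normalizer ((D.PiXund : Subgroup D.PiC) : Set D.PiC)))
    (hn : (n : D.PiC) ∈ D.PiCund) : D.actFSlope CG hS n = 1 ∨ D.actFSlope CG hS n = -1 := by
  obtain ⟨c, hc, hcn⟩ := Subgroup.mem_map.mp hn
  have hn' : D.geom.embK c ∈ Subgroup.normalizer ((D.PiXund : Subgroup D.PiC) : Set D.PiC) := by rw [hcn]; exact n.2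
  have heq : n = ⟨D.geom.embK c, hn'⟩ := Subtype.ext hcn.symm
  by_cases hcX : c ∈ D.geom.pe.PiX
  · left
    rw [heq]
    exact D.actFSlope_embK_of_mem_PiX CG hS hcX hn'
  · right
    rw [heq]
    exact D.actFSlope_embK_of_not_mem_PiX CG hS hc hcX hn'

end InitialThetaData

end LabelAffine

end Literature.IUT.HodgeTheaters
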